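import Literature.NumberTheory.Automorphic.BianchiCuspDepth
import HarnessLib

/-!
# Dirichlet's pigeonhole for Bianchi groups: every form is shallow at some cusp

Topic `NumberTheory/Automorphic`; namespace `Literature.NumberTheory.Automorphic`, grouping
sub-namespace `BianchiCusp`.  Theorems only.

For an imaginary quadratic field `K` with complex embedding `σ` there is a constant `C = C(K)`
such that EVERY positive definite binary Hermitian form `H` takes a value
`H[σ v] ≤ C · √det H` at some non-zero integral vector `v ∈ 𝓞_K²` (`exists_qf_le_mul_rdet`);
consequently some cusp has depth `≤ C` at `H` (`exists_depth_le`).  This is the "Minkowski"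
input of the reduction theory of Bianchi groups ([ElstrodtGrunewaldMennicke1998, Ch. 7 §7.2–7.3,
Prop. 2.6 / the finiteness of the fundamental domain]; [Swan1971, §3–§4]), proved here by
Dirichlet's box principle instead of the geometry of numbers: completing the square,
`H[v] = p|v₀ + c v₁|² + (det H / p)|v₁|²`; if `p ≤ √det H` take `v = (1, 0)`; otherwise, with
`n ≈ √p / det^{1/4}`, among the `(n+1)²` integers `y = a + b ω` (`0 ≤ a, b ≤ n`, `σ ω ∉ ℝ`) two
have `c σ(y)` in the same of `n²` cells of a fundamental parallelogram of `ℤ + ℤ σω`, so that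
`v₁ = y - y'`, `v₀ = -ℓ` (`ℓ` the difference of the lattice parts) give
`|σ v₀ + c σ v₁| ≤ (1 + |σω|)/n` and `|σ v₁| ≤ (1 + |σω|) n`, whence `H[v] ≤ 5 (1 + |σω|)² √det H`.

## References

* J. Elstrodt, F. Grunewald, J. Mennicke, *Groups Acting on Hyperbolic Space* (1998), Ch. 7
  §7.2–7.3 [ElstrodtGrunewaldMennicke1998].
* R. G. Swan, Adv. Math. 6 (1971), §3–§4 [Swan1971].
-/

noncomputable section

open Matrix Complex NumberField
open scoped ComplexConjugate

namespace Literature.NumberTheory.Automorphic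

namespace BianchiCusp

open BianchiCone Literature.NumberTheory.NumberFields

variable {K : Type*} [Field K] [NumberField K] (σ : K →+* ℂ)

/-! ### Real coordinates in the basis `1, σω` -/

/-- The second coordinate of `ξ` in the real basis `1, w` of `ℂ` (`Im w ≠ 0`). [folklore] -/
theorem coord_decomp {w : ℂ} (hw : w.im ≠ 0) (ξ : ℂ) :
    ξ = ((ξ.re - ξ.im / w.im * w.re : ℝ) : ℂ) + ((ξ.im / w.im : ℝ) : ℂ) * w := by
  apply Complex.ext
  · simp
  · simp only [Complex.add_im, Complex.ofReal_im, Complex.mul_im, Complex.ofReal_re, zero_mul,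
      add_zero, zero_add]
    field_simp

/-- Two reals whose scaled fractional parts have the same integer part differ from the
difference of their integer parts by less than `1/n`. [folklore] -/
theorem abs_sub_sub_floor_lt {n : ℕ} (hn : 0 < n) {s s' : ℝ}
    (h : ⌊(n : ℝ) * Int.fract s⌋ = ⌊(n : ℝ) * Int.fract s'⌋) :
    |s - s' - ((⌊s⌋ - ⌊s'⌋ : ℤ) : ℝ)| < 1 / n := by
  have h1 := Int.abs_sub_lt_one_of_floor_eq_floor h
  rw [← mul_sub, abs_mul, Nat.abs_cast] at h1
  have hn' : (0 : ℝ) < n := by exact_mod_cast hn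
  rw [lt_div_iff₀ hn', mul_comm]
  have e : s - s' - ((⌊s⌋ - ⌊s'⌋ : ℤ) : ℝ) = Int.fract s - Int.fract s' := by
    rw [Int.fract, Int.fract]; push_cast; ring
  rwa [e]

/-- The cell index of a real number: `⌊n · fract s⌋ ∈ {0, …, n-1}`. [folklore] -/
theorem floor_mul_fract_lt {n : ℕ} (hn : 0 < n) (s : ℝ) :
    (⌊(n : ℝ) * Int.fract s⌋).toNat < n := by
  have h0 : 0 ≤ (n : ℝ) * Int.fract s := mul_nonneg (Nat.cast_nonneg _) (Int.fract_nonneg s)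
  have h1 : (n : ℝ) * Int.fract s < n := by
    have := Int.fract_lt_one s
    have hn' : (0 : ℝ) < n := by exact_mod_cast hn
    nlinarith
  have hfl : ⌊(n : ℝ) * Int.fract s⌋ < n := Int.floor_lt.2 (by exact_mod_cast h1)
  have hnn : 0 ≤ ⌊(n : ℝ) * Int.fract s⌋ := Int.floor_nonneg.2 h0
  omega

/-! ### The pigeonhole -/

/-- **Dirichlet's approximation in `ℤ + ℤω`**: for `c ∈ ℂ` and `n ≥ 1` there are integers
`v₁ = (a - a') + (b - b')ω ≠ 0` with `|a - a'|, |b - b'| ≤ n` and `ℓ ∈ ℤ + ℤω` with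
`|c σ(v₁) - σ(ℓ)| ≤ (1 + |σω|)/n` and `|σ v₁| ≤ (1 + |σω|) n`. [cite: ElstrodtGrunewaldMennicke1998, Ch. 7 §7.3] -/
theorem exists_approx {ω : 𝓞 K} (hω : (σ ω).im ≠ 0) (c : ℂ) {n : ℕ} (hn : 0 < n) :
    ∃ v₁ ℓ : 𝓞 K, v₁ ≠ 0 ∧ ‖c * σ v₁ - σ ℓ‖ ≤ (1 + ‖σ (ω : K)‖) / n ∧
      ‖σ (v₁ : K)‖ ≤ (1 + ‖σ (ω : K)‖) * n := by
  set w : ℂ := σ ω with hwdef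
  -- coordinates and cells
  let ξ : Fin (n + 1) × Fin (n + 1) → ℂ := fun q => c * ((q.1 : ℕ) + (q.2 : ℕ) * w)
  let sc : ℂ → ℝ := fun x => x.re - x.im / w.im * w.re
  let tc : ℂ → ℝ := fun x => x.im / w.im
  let cell : Fin (n + 1) × Fin (n + 1) → Fin n × Fin n := fun q =>
    (⟨(⌊(n : ℝ) * Int.fract (sc (ξ q))⌋).toNat, floor_mul_fract_lt hn _⟩,
     ⟨(⌊(n : ℝ) * Int.fract (tc (ξ q))⌋).toNat, floor_mul_fract_lt hn _⟩)
  have hcard : Fintype.card (Fin n × Fin n) < Fintype.card (Fin (n + 1) × Fin (n + 1)) := by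
    simp only [Fintype.card_prod, Fintype.card_fin]
    nlinarith
  obtain ⟨q, q', hqq', hcell⟩ := Fintype.exists_ne_map_eq_of_card_lt cell hcard
  simp only [cell, Prod.mk.injEq, Fin.mk.injEq] at hcell
  -- the floors agree
  have hfloor_eq : ∀ {x y : ℝ}, (⌊(n : ℝ) * Int.fract x⌋).toNat = (⌊(n : ℝ) * Int.fract y⌋).toNat →
      ⌊(n : ℝ) * Int.fract x⌋ = ⌊(n : ℝ) * Int.fract y⌋ := by
    intro x y hxy
    have hx : 0 ≤ ⌊(n : ℝ) * Int.fract x⌋ := Int.floor_nonneg.2 (mul_nonneg (Nat.cast_nonneg _) (Int.fract_nonneg x))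
    have hy : 0 ≤ ⌊(n : ℝ) * Int.fract y⌋ := Int.floor_nonneg.2 (mul_nonneg (Nat.cast_nonneg _) (Int.fract_nonneg y))
    omega
  have hs := abs_sub_sub_floor_lt hn (hfloor_eq hcell.1)
  have ht := abs_sub_sub_floor_lt hn (hfloor_eq hcell.2)
  -- the vectors
  set a : ℤ := ((q.1 : ℕ) : ℤ) with ha
  set b : ℤ := ((q.2 : ℕ) : ℤ) with hb
  set a' : ℤ := ((q'.1 : ℕ) : ℤ) with ha'
  set b' : ℤ := ((q'.2 : ℕ) : ℤ) with hb'
  set ms : ℤ := ⌊sc (ξ q)⌋ - ⌊sc (ξ q')⌋ with hms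
  set mt : ℤ := ⌊tc (ξ q)⌋ - ⌊tc (ξ q')⌋ with hmt
  refine ⟨(a - a' : ℤ) + (b - b' : ℤ) * ω, (ms : 𝓞 K) + (mt : 𝓞 K) * ω, ?_, ?_, ?_⟩
  · -- non-zero: `1, σω` are `ℝ`-independent
    intro h0
    have h1 : σ (((a - a' : ℤ) + (b - b' : ℤ) * ω : 𝓞 K) : K) = 0 := by rw [h0]; simp
    have h2 : σ (((a - a' : ℤ) + (b - b' : ℤ) * ω : 𝓞 K) : K) = ((a - a' : ℤ) : ℂ) + ((b - b' : ℤ) : ℂ) * w := by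
      push_cast; simp [map_add, map_mul, hwdef]
    rw [h2] at h1
    have him := congrArg Complex.im h1
    simp only [Complex.add_im, Complex.intCast_im, Complex.mul_im, Complex.intCast_re, zero_add,
      zero_mul, add_zero, Complex.zero_im, mul_eq_zero, hω, or_false] at him
    have hre := congrArg Complex.re h1
    simp only [Complex.add_re, Complex.intCast_re, Complex.mul_re, Complex.intCast_im, zero_mul,
      sub_zero, Complex.zero_re] at hre
    have hbb : b - b' = 0 := by exact_mod_cast him
    rw [hbb, Int.cast_zero, zero_mul, add_zero] at hre
    have haa : a - a' = 0 := by exact_mod_cast hre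
    apply hqq'
    have h3 : (q.1 : ℕ) = q'.1 := by
      have := sub_eq_zero.1 haa
      rw [ha, ha'] at this
      exact_mod_cast this
    have h4 : (q.2 : ℕ) = q'.2 := by
      have := sub_eq_zero.1 hbb
      rw [hb, hb'] at this
      exact_mod_cast this
    exact Prod.ext (Fin.ext h3) (Fin.ext h4)
  · -- the approximation
    have hξ : c * σ (((a - a' : ℤ) + (b - b' : ℤ) * ω : 𝓞 K) : K) = ξ q - ξ q' := by
      have : σ (((a - a' : ℤ) + (b - b' : ℤ) * ω : 𝓞 K) : K) = ((a - a' : ℤ) : ℂ) + ((b - b' : ℤ) : ℂ) * w := by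
        push_cast; simp [map_add, map_mul, hwdef]
      rw [this]
      simp only [ξ, ha, hb, ha', hb']
      push_cast
      ring
    have hℓ : σ (((ms : 𝓞 K) + (mt : 𝓞 K) * ω : 𝓞 K) : K) = (ms : ℂ) + (mt : ℂ) * w := by
      push_cast; simp [map_add, map_mul, hwdef]
    rw [hξ, hℓ, coord_decomp hω (ξ q), coord_decomp hω (ξ q')]
    have e : ((sc (ξ q) : ℝ) : ℂ) + ((tc (ξ q) : ℝ) : ℂ) * w - (((sc (ξ q') : ℝ) : ℂ) + ((tc (ξ q') : ℝ) : ℂ) * w) -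
        ((ms : ℂ) + (mt : ℂ) * w) =
        ((sc (ξ q) - sc (ξ q') - (ms : ℝ) : ℝ) : ℂ) + ((tc (ξ q) - tc (ξ q') - (mt : ℝ) : ℝ) : ℂ) * w := by
      push_cast; ring
    rw [show ((((ξ q).re - (ξ q).im / w.im * w.re : ℝ) : ℂ) + (((ξ q).im / w.im : ℝ) : ℂ) * w -
        ((((ξ q').re - (ξ q').im / w.im * w.re : ℝ) : ℂ) + (((ξ q').im / w.im : ℝ) : ℂ) * w) -
        ((ms : ℂ) + (mt : ℂ) * w)) =
        ((sc (ξ q) - sc (ξ q') - (ms : ℝ) : ℝ) : ℂ) + ((tc (ξ q) - tc (ξ q') - (mt : ℝ) : ℝ) : ℂ) * w from e]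
    calc ‖((sc (ξ q) - sc (ξ q') - (ms : ℝ) : ℝ) : ℂ) + ((tc (ξ q) - tc (ξ q') - (mt : ℝ) : ℝ) : ℂ) * w‖
        ≤ ‖((sc (ξ q) - sc (ξ q') - (ms : ℝ) : ℝ) : ℂ)‖ + ‖((tc (ξ q) - tc (ξ q') - (mt : ℝ) : ℝ) : ℂ) * w‖ :=
          norm_add_le _ _
      _ = |sc (ξ q) - sc (ξ q') - (ms : ℝ)| + |tc (ξ q) - tc (ξ q') - (mt : ℝ)| * ‖w‖ := by
          rw [norm_mul, Complex.norm_real, Complex.norm_real, Real.norm_eq_abs, Real.norm_eq_abs]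
      _ ≤ 1 / n + 1 / n * ‖w‖ := by
          have hs' : |sc (ξ q) - sc (ξ q') - (ms : ℝ)| ≤ 1 / n := by push_cast [hms] at hs ⊢; exact hs.le
          have ht' : |tc (ξ q) - tc (ξ q') - (mt : ℝ)| ≤ 1 / n := by push_cast [hmt] at ht ⊢; exact ht.le
          gcongr
      _ = (1 + ‖w‖) / n := by ring
  · -- the size of `v₁`
    have : σ (((a - a' : ℤ) + (b - b' : ℤ) * ω : 𝓞 K) : K) = ((a - a' : ℤ) : ℂ) + ((b - b' : ℤ) : ℂ) * w := by
      push_cast; simp [map_add, map_mul, hwdef]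
    rw [this]
    have haa : |((a - a' : ℤ) : ℝ)| ≤ n := by
      rw [abs_le]
      have h1 : (q.1 : ℕ) ≤ n := Nat.lt_succ_iff.1 q.1.2
      have h2 : (q'.1 : ℕ) ≤ n := Nat.lt_succ_iff.1 q'.1.2
      constructor <;> push_cast [ha, ha'] <;>
        [linarith [(Nat.cast_nonneg (q.1 : ℕ) : (0:ℝ) ≤ _), (by exact_mod_cast h2 : ((q'.1 : ℕ) : ℝ) ≤ n)];
         linarith [(Nat.cast_nonneg (q'.1 : ℕ) : (0:ℝ) ≤ _), (by exact_mod_cast h1 : ((q.1 : ℕ) : ℝ) ≤ n)]]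
    have hbb : |((b - b' : ℤ) : ℝ)| ≤ n := by
      rw [abs_le]
      have h1 : (q.2 : ℕ) ≤ n := Nat.lt_succ_iff.1 q.2.2
      have h2 : (q'.2 : ℕ) ≤ n := Nat.lt_succ_iff.1 q'.2.2
      constructor <;> push_cast [hb, hb'] <;>
        [linarith [(Nat.cast_nonneg (q.2 : ℕ) : (0:ℝ) ≤ _), (by exact_mod_cast h2 : ((q'.2 : ℕ) : ℝ) ≤ n)];
         linarith [(Nat.cast_nonneg (q'.2 : ℕ) : (0:ℝ) ≤ _), (by exact_mod_cast h1 : ((q.2 : ℕ) : ℝ) ≤ n)]]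
    calc ‖((a - a' : ℤ) : ℂ) + ((b - b' : ℤ) : ℂ) * w‖
        ≤ ‖((a - a' : ℤ) : ℂ)‖ + ‖((b - b' : ℤ) : ℂ) * w‖ := norm_add_le _ _
      _ = |((a - a' : ℤ) : ℝ)| + |((b - b' : ℤ) : ℝ)| * ‖w‖ := by
          rw [norm_mul, ← Complex.ofReal_intCast, ← Complex.ofReal_intCast, Complex.norm_real,
            Complex.norm_real, Real.norm_eq_abs, Real.norm_eq_abs]
      _ ≤ n + n * ‖w‖ := by gcongr
      _ = (1 + ‖w‖) * n := by ring

/-! ### Every form is shallow at some cusp -/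

/-- **Dirichlet–Minkowski for Bianchi groups**: there is `C = C(K) > 0` such that every
positive definite binary Hermitian form takes a value `H[σ v] ≤ C √det H` at a non-zero
integral vector. [cite: ElstrodtGrunewaldMennicke1998, Ch. 7 §7.3] -/
theorem exists_qf_le_mul_rdet [IsTotallyComplex K] :
    ∃ C : ℝ, 0 < C ∧ ∀ H ∈ cone, ∃ v : OVec K, v ≠ 0 ∧ qf H (emb σ v) ≤ C * rdet H := by
  obtain ⟨ω, hω⟩ := ImaginaryQuadratic.exists_im_ne_zero (K := K) σ
  set L : ℝ := 1 + ‖σ (ω : K)‖ with hL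
  have hL0 : 0 < L := by positivity
  refine ⟨max 1 (5 * L ^ 2), by positivity, fun H hH => ?_⟩
  have hherm := hH.1
  have hp := hH.2.1
  have hd := hH.2.2
  have hr := rdet_pos hH
  set p : ℝ := (H 0 0).re with hpdef
  by_cases hcase : p ≤ rdet H
  · -- the first basis vector
    refine ⟨Pi.single 0 1, ?_, ?_⟩
    · intro h
      have := congrFun h 0
      simp at this
    · have hemb : emb σ (Pi.single 0 1 : OVec K) = Pi.single 0 1 := by
        funext i
        fin_cases i <;> simp [emb]
      rw [hemb, qf_single_zero]
      calc (H 0 0).re ≤ rdet H := hcase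
        _ = 1 * rdet H := (one_mul _).symm
        _ ≤ max 1 (5 * L ^ 2) * rdet H := mul_le_mul_of_nonneg_right (le_max_left _ _) hr.le
  · push Not at hcase
    -- the parameter `n ≈ √p / det^{1/4}`
    set ρ : ℝ := Real.sqrt p / Real.sqrt (rdet H) with hρ
    have hsp : 0 < Real.sqrt p := Real.sqrt_pos.2 hp
    have hsr : 0 < Real.sqrt (rdet H) := Real.sqrt_pos.2 hr
    have hρ1 : 1 ≤ ρ := by
      rw [hρ, le_div_iff₀ hsr, one_mul]
      exact Real.sqrt_le_sqrt hcase.le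
    set n : ℕ := ⌈ρ⌉₊ with hndef
    have hn : 0 < n := Nat.ceil_pos.2 (by linarith)
    have hnρ : ρ ≤ n := Nat.le_ceil ρ
    have hn2 : (n : ℝ) ≤ 2 * ρ := by
      have := Nat.ceil_lt_add_one (by linarith : (0 : ℝ) ≤ ρ)
      rw [← hndef] at this
      linarith
    set c : ℂ := H 0 1 / (p : ℂ) with hcdef
    obtain ⟨v₁, ℓ, hv₁, happrox, hsize⟩ := exists_approx σ hω c hn
    refine ⟨![-ℓ, v₁], ?_, ?_⟩
    · intro h
      have := congrFun h 1
      simp only [cons_val_one, cons_val_fin_one, Pi.zero_apply] at this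
      exact hv₁ this
    · have hqf := qf_eq_completeSquare hherm hp (emb σ ![-ℓ, v₁])
      rw [hqf]
      have hn' : (0 : ℝ) < n := by exact_mod_cast hn
      -- the two squares
      have h1 : Complex.normSq (emb σ ![-ℓ, v₁] 0 + H 0 1 / ((H 0 0).re : ℂ) * emb σ ![-ℓ, v₁] 1) ≤ (L / n) ^ 2 := by
        have e : emb σ ![-ℓ, v₁] 0 + H 0 1 / ((H 0 0).re : ℂ) * emb σ ![-ℓ, v₁] 1 = c * σ v₁ - σ ℓ := by
          simp [emb, hcdef, hpdef]; ring
        rw [e, Complex.normSq_eq_norm_sq]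
        exact pow_le_pow_left₀ (norm_nonneg _) happrox 2
      have h2 : Complex.normSq (emb σ ![-ℓ, v₁] 1) ≤ (L * n) ^ 2 := by
        have e : emb σ ![-ℓ, v₁] 1 = σ v₁ := by simp [emb]
        rw [e, Complex.normSq_eq_norm_sq]
        exact pow_le_pow_left₀ (norm_nonneg _) hsize 2
      -- the two comparisons with `rdet`
      have hsq_p : Real.sqrt p ^ 2 = p := Real.sq_sqrt hp.le
      have hsq_r : Real.sqrt (rdet H) ^ 2 = rdet H := Real.sq_sqrt hr.le
      have hρ2 : ρ ^ 2 = p / rdet H := by rw [hρ, div_pow, hsq_p, hsq_r]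
      have hA : p / (n : ℝ) ^ 2 ≤ rdet H := by
        rw [div_le_iff₀ (by positivity)]
        have : ρ ^ 2 ≤ (n : ℝ) ^ 2 := pow_le_pow_left₀ (by linarith) hnρ 2
        rw [hρ2, div_le_iff₀ hr] at this
        linarith
      have hB : hdet H / p * (n : ℝ) ^ 2 ≤ 4 * rdet H := by
        have hdet' : hdet H = rdet H ^ 2 := (rdet_sq hH).symm
        have : (n : ℝ) ^ 2 ≤ 4 * ρ ^ 2 := by nlinarith
        rw [hρ2] at this
        rw [hdet', div_mul_eq_mul_div, div_le_iff₀ hp]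
        calc rdet H ^ 2 * (n : ℝ) ^ 2 ≤ rdet H ^ 2 * (4 * (p / rdet H)) := by
              exact mul_le_mul_of_nonneg_left this (sq_nonneg _)
          _ = 4 * rdet H * p := by field_simp
      -- assemble
      calc (H 0 0).re * Complex.normSq (emb σ ![-ℓ, v₁] 0 + H 0 1 / ((H 0 0).re : ℂ) * emb σ ![-ℓ, v₁] 1) +
            hdet H / (H 0 0).re * Complex.normSq (emb σ ![-ℓ, v₁] 1)
          ≤ p * (L / n) ^ 2 + hdet H / p * (L * n) ^ 2 :=
            add_le_add (mul_le_mul_of_nonneg_left h1 hp.le) (mul_le_mul_of_nonneg_left h2 (div_pos hd hp).le)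
        _ = L ^ 2 * (p / (n : ℝ) ^ 2) + L ^ 2 * (hdet H / p * (n : ℝ) ^ 2) := by
            field_simp
        _ ≤ L ^ 2 * rdet H + L ^ 2 * (4 * rdet H) :=
            add_le_add (mul_le_mul_of_nonneg_left hA (sq_nonneg _)) (mul_le_mul_of_nonneg_left hB (sq_nonneg _))
        _ = 5 * L ^ 2 * rdet H := by ring
        _ ≤ max 1 (5 * L ^ 2) * rdet H := mul_le_mul_of_nonneg_right (le_max_right _ _) hr.le

/-- **Every form is shallow at some cusp**: with `C = C(K)`, for every `H` in the cone there is a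
non-zero integral `v` with `depth σ v H ≤ C`. [cite: ElstrodtGrunewaldMennicke1998, Ch. 7 §7.3] -/
theorem exists_depth_le [IsTotallyComplex K] :
    ∃ C : ℝ, 0 < C ∧ ∀ H ∈ cone, ∃ v : OVec K, v ≠ 0 ∧ depth σ v H ≤ C := by
  obtain ⟨C, hC, h⟩ := exists_qf_le_mul_rdet (K := K) σ
  refine ⟨C, hC, fun H hH => ?_⟩
  obtain ⟨v, hv, hle⟩ := h H hH
  refine ⟨v, hv, ?_⟩
  have hr := rdet_pos hH
  have hN : (1 : ℝ) ≤ Ideal.absNorm (idealOf v) := by exact_mod_cast absNorm_idealOf_pos hv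
  unfold depth
  rw [div_le_iff₀ (by positivity)]
  calc qf H (emb σ v) ≤ C * rdet H := hle
    _ = C * (1 * rdet H) := by rw [one_mul]
    _ ≤ C * ((Ideal.absNorm (idealOf v) : ℝ) * rdet H) :=
        mul_le_mul_of_nonneg_left (mul_le_mul_of_nonneg_right hN hr.le) hC.le

end BianchiCusp

end Literature.NumberTheory.Automorphic
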